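import Summits.BirchSwinnertonDyer.BirchSwinnertonDyer.Theorems.CMKolyvaginAtInertTwoRootClassAtTwoPow
import Literature.NumberTheory.EllipticCurves.HeegnerPointsOfConductor
import HarnessLib

/-!
# Route `CMKolyvaginAtInertTwo`, crux `CMKolyvaginConjectureAtInertTwo` (stmt-BirchSwinnertonDyer-24648),
# stub `stub_positiveDepth` — THE ROOT CLASS OF A KOLYVAGIN–HEEGNER DATUM AT `p = 2`
# (file #1's `exists_rootClass_two_pow` in the currency of the crux and of hands 5/6: `e.kolyvaginClass 2 L`,
# `E(K[n]) = e.pointsSubgroup`, `P_e(n) = e.derivedPoint`, `2^{m} ∣ P_e(n)` in `E(K[n])`)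

Seat `leafhand-bsd-cmkolyvaginatinert-7` g0 (cell `bsd-eis`); helper `--supports stmt-BirchSwinnertonDyer-24648`.
THEOREMS ONLY: no definition, no named fact, no `sorry`; nothing is closed; BSD is proved for no curve.

WHAT.  Hands 5/6 (`…FirstDescentDepthBound`, `…StrictDescentObstructionClass`, `…ObstructionClassOrderAndSha`)
measure the first descent at `2` on H₂ by `m(ℓ) = ord₂ P_e(ℓ)` in `E(K[ℓ])` and by the intrinsic classes
`c_L(ℓ) = e.kolyvaginClass 2 L` of a Kolyvagin–Heegner datum `e` of conductor `ℓ`; hand 6's census asked for «the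
`2^{m(ℓ)}`-th ROOT `c̃` of `c_L(ℓ)` … Selmer conditions transfer through `i_* = torsionH1OfDvd`».  File #1 of this
seat built that root for the machine's ABSTRACT data (`A`, `P`); this file is the one-step specialisation to a
datum `e : KolyvaginHeegnerData Dt β ι n`: `A := e.pointsSubgroup`, `P := e.toGeomPoints e.derivedPoint`, the root
`Q := e.toGeomPoints Q₀` for any `Q₀ ∈ E(K[n])` with `2^{m} Q₀ = P_e(n)`, and `e.kolyvaginClass 2 (M + m)` is
McCallum's class of `P` (`KolyvaginHeegnerData.kolyvaginClass_of_admissible`) under the two standing inputs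
(Gross Lemma 4.3 admissibility at `2^{M+m}`, Prop. 3.6 invariance mod `2^{M+m}` — hypotheses here, tree theorems
on H₂ at the Zhang–Kolyvagin levels, as used by hands 5/6).
* `exists_rootClass_of_kolyvaginHeegnerData_two_pow` — `∃ c̃ ∈ H¹(K, E[2^M])` with `ι_* c̃ = c_{M+m}(e)`, the same
  `Gal(K/ℚ)`-sign as `c_{M+m}(e)`, and `k·c̃` Selmer at a `K`-field `E` iff `k·c_{M+m}(e)` is (every `k ∈ ℤ`).
* `exists_rootClass_of_kolyvaginHeegnerData_two_pow_of_ne_zero` — the same with the standing inputs read off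
  `c_{M+m}(e) ≠ 0` (a non-zero intrinsic class is never the junk value).

HONEST FRAMING: bookkeeping (instantiation of file #1); the refined descent itself is file #2
(`…MinusPartRefinedDescentAtTwoPow`), whose root hypothesis this makes legible in the crux's currency; feeding
H₂'s point system to file #2 BY NAME still wants the assembly `PointSystemHloc.hpoints_at_of_perLevelChoice_…`
re-threaded with its data named (census L1′).  References: [McCallumLMS1991] §4 (4)–(6), Lemma 4.6, §5 (before
Prop. 5.2); [GrossLMS1991] §4 (4.4)–(4.6), Lemma 4.3, Prop. 3.6.
presearch: tree re-keying only (`lean search 'rootClass'`, `'levelOne_avatar'`: the `p`-odd twins); print = McCallum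
§5 at odd `p` [corpus: book:editornd-l-functions-arithmetic p0285].
-/

-- single-conjunct summit: `Summit.BirchSwinnertonDyer.BirchSwinnertonDyer.…` repeats the name by design
set_option linter.dupNamespace false
set_option autoImplicit false

noncomputable section

open scoped Classical
open WeierstrassCurve NumberField Field
open Literature.NumberTheory.GaloisRepresentations Literature.NumberTheory.EllipticCurves
open Literature.NumberTheory.EllipticCurves.ModularForms
open Literature.NumberTheory.EllipticCurves.KolyvaginCocycle

namespace Summit.BirchSwinnertonDyer.BirchSwinnertonDyer.Theorems.KolyvaginDescentTwo

variable (W : WeierstrassCurve ℚ) {K : Type} [Field K] [NumberField K]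

/-- **The root class of a Kolyvagin–Heegner datum at `2`.**  `E/ℚ` with `ρ̄_{E,2}` onto, `K` imaginary quadratic,
`e` a Kolyvagin–Heegner datum of conductor `n` (frame `Dt, β, ι`) whose `E(K[n]) ⊆ E(K̄)` is admissible at `2^{M+m}`
and whose `[P_e(n)]` is `Γ_K`-invariant mod `2^{M+m}`, and `Q₀ ∈ E(K[n])` with `2^m Q₀ = P_e(n)`.  If
`c_* c_{M+m}(e) = ν c_{M+m}(e)` then there is `c̃ ∈ H¹(K, E[2^M])` with `ι_* c̃ = c_{M+m}(e)`, `c_* c̃ = ν c̃`, and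
`k·c̃ ∈ ker(H¹(K, E[2^M]) → H¹(E, E))` iff `k·c_{M+m}(e) ∈ ker(H¹(K, E[2^{M+m}]) → H¹(E, E))` for every `K`-field
`E` and `k ∈ ℤ`. [cite: McCallumLMS1991, §4 (4)–(6), Lemma 4.6, §5 (before Prop. 5.2)] [cite: GrossLMS1991, §4 (4.4)–(4.6)] -/
theorem exists_rootClass_of_kolyvaginHeegnerData_two_pow [W.IsElliptic] (hK : IsImaginaryQuadratic K)
    (hρ : W.HasSurjectiveModNGaloisRep 2) (c : K ≃ₐ[ℚ] K) {N : ℕ} [NeZero N] {Dt : ModularParametrizationData W N}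
    {β : ℤ} {ι : K →+* ℂ} {n : ℕ} (e : KolyvaginHeegnerData Dt β ι n) {M m : ℕ}
    (hA : IsAdmissible (absoluteGaloisGroup K) e.pointsSubgroup ((2 ^ (M + m) : ℕ) : ℤ))
    (hP : e.toGeomPoints e.derivedPoint ∈
      invPoints (absoluteGaloisGroup K) e.pointsSubgroup ((2 ^ (M + m) : ℕ) : ℤ))
    {Q₀ : (W.baseChange (ringClassField K ι n)).toAffine.Point}
    (hQ₀ : (((2 : ℕ) : ℤ) ^ m) • Q₀ = e.derivedPoint) {ν : ℤ}
    (hdeig : conjAct W c _ (e.kolyvaginClass Nat.prime_two (M + m)) =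
      ν • e.kolyvaginClass Nat.prime_two (M + m)) :
    ∃ d : galH1Torsion (W.baseChange K) ((2 ^ M : ℕ) : ℤ),
      torsionH1OfDvd (W.baseChange K) (natCast_pow_dvd_natCast_pow_add 2 M m) d =
          e.kolyvaginClass Nat.prime_two (M + m) ∧
        conjAct W c _ d = ν • d ∧
        ∀ (E : Type) [Field E] [Algebra K E] (k : ℤ),
          k • d ∈ selmerLocalKer (W.baseChange K) E ((2 ^ M : ℕ) : ℤ) ↔
            k • e.kolyvaginClass Nat.prime_two (M + m) ∈
              selmerLocalKer (W.baseChange K) E ((2 ^ (M + m) : ℕ) : ℤ) := by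
  rw [e.kolyvaginClass_of_admissible Nat.prime_two (M + m) hA hP] at hdeig ⊢
  have hq0 : ((2 ^ M : ℕ) : ℤ) ≠ 0 := by exact_mod_cast pow_ne_zero M two_ne_zero
  exact exists_rootClass_two_pow W hK hρ c ((W.baseChange K).zsmul_geomPoints_surjective_holds hq0) _ hA hP
    (Q := e.toGeomPoints Q₀) ⟨Q₀, rfl⟩ (by rw [← map_zsmul, hQ₀]) hdeig

/-- **The same with the standing inputs read off `c_{M+m}(e) ≠ 0`** (a non-zero intrinsic class is McCallum's
class: `KolyvaginHeegnerData.kolyvaginClass_ne_zero`). [cite: McCallumLMS1991, §4 (4)–(6), Lemma 4.6]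
[cite: GrossLMS1991, §4 (4.4)–(4.6)] -/
theorem exists_rootClass_of_kolyvaginHeegnerData_two_pow_of_ne_zero [W.IsElliptic]
    (hK : IsImaginaryQuadratic K) (hρ : W.HasSurjectiveModNGaloisRep 2) (c : K ≃ₐ[ℚ] K) {N : ℕ} [NeZero N]
    {Dt : ModularParametrizationData W N} {β : ℤ} {ι : K →+* ℂ} {n : ℕ} (e : KolyvaginHeegnerData Dt β ι n)
    {M m : ℕ} (hne : e.kolyvaginClass Nat.prime_two (M + m) ≠ 0)
    {Q₀ : (W.baseChange (ringClassField K ι n)).toAffine.Point}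
    (hQ₀ : (((2 : ℕ) : ℤ) ^ m) • Q₀ = e.derivedPoint) {ν : ℤ}
    (hdeig : conjAct W c _ (e.kolyvaginClass Nat.prime_two (M + m)) =
      ν • e.kolyvaginClass Nat.prime_two (M + m)) :
    ∃ d : galH1Torsion (W.baseChange K) ((2 ^ M : ℕ) : ℤ),
      torsionH1OfDvd (W.baseChange K) (natCast_pow_dvd_natCast_pow_add 2 M m) d =
          e.kolyvaginClass Nat.prime_two (M + m) ∧
        conjAct W c _ d = ν • d ∧
        ∀ (E : Type) [Field E] [Algebra K E] (k : ℤ),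
          k • d ∈ selmerLocalKer (W.baseChange K) E ((2 ^ M : ℕ) : ℤ) ↔
            k • e.kolyvaginClass Nat.prime_two (M + m) ∈
              selmerLocalKer (W.baseChange K) E ((2 ^ (M + m) : ℕ) : ℤ) :=
  exists_rootClass_of_kolyvaginHeegnerData_two_pow W hK hρ c e (e.kolyvaginClass_ne_zero hne).1
    (e.kolyvaginClass_ne_zero hne).2 hQ₀ hdeig

end Summit.BirchSwinnertonDyer.BirchSwinnertonDyer.Theorems.KolyvaginDescentTwo

end
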